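import Summits.SmoothPoincare4.SmoothPoincare4.Theses.CongruenceShadows
import Summits.SmoothPoincare4.SmoothPoincare4.Theorems.WaldhausenPairs.Negative.LoadBearing
import Literature.Topology.FourManifolds.ProfiniteDetectionSumS1S2

/-!
# Stub P2 `stub_profiniteFreenessDetection` of line `pair-rigidity-retraction` for crux
`CongruenceShadows.HeegaardHandlebodyCongruenceClosed` (item stmt-SmoothPoincare4-14596): the CONDITIONAL derivation

Notation: `S = S_{3+3m} = SurfaceGroup (3+3m)`, `N = (N₀,N₁,N₂) = s4Kernels.stabilizeIter m` (the standard
genus-`(3+3m)` trisection kernels of `S⁴`), `θ ∈ Aut S`, `θN₂ = (N 2).map θ`.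

**P2 (profinite detection of freeness).**  For `i ≠ 2` and `θ ∈ Aut S`: if the twisted pair quotient
`G = S ⧸ ⟪N_i ∪ θN₂⟫` has exactly the finite quotients of `F_{m+1}`, then `G` is free of rank `m+1`.

This is a theorem in print modulo the kernel ↔ Heegaard-splitting bridge and is NOT provable inside the
tree (the 3-manifold side is not formalised): `N_i`, `θN₂` are handlebody kernels, so `G = π₁(Y)` for the
closed orientable 3-manifold `Y = H_i ∪_θ H₂` (Jaco 1969 = Hempel Lemma 14.5, van Kampen = Lemma 14.4);
`Ĝ ≅ F̂_{m+1}` (Dixon–Formanek–Poland–Ribes 1982), so by Wilton–Zalesskii (2019), Thm. A (profinite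
Kneser–Milnor) `Y ≅ #^{m+1}(S¹ × S²)` and `G ≅ F_{m+1}`.  The literature debt is filed as the Literature
proposal `Literature/Topology/FourManifolds/ProfiniteDetectionSumS1S2.lean` (two named facts
`isFreeOfRank_fundamentalGroup_of_sameFiniteQuotients` [WZ19 Thm. A for `#ᵏ S¹ × S²`, on `π₁`] and
`exists_closedThreeManifold_fundamentalGroup_pairQuotient` [Hempel 14.5 + 14.4], and the PROVED
group-theoretic corollary `isFreeOfRank_pairQuotient_of_sameFiniteQuotients`).

This file proves `stub_profiniteFreenessDetection_of_fact : <that corollary, UNFOLDED> → <registered P2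
signature>`: instantiate at `g = 3+3m`, `k = m+1`, `K₁ = N_i`, `K₂ = θN₂`; the two rank-`g` freeness
inputs are `stabilizeIter_isGroupTrisection` (for `N_i`) and its transport along `θ` (for `θN₂`,
`p2_isFreeOfRank_quotient_normalClosure_map`).  Once the Literature file lands, the stub closes as
`stub_profiniteFreenessDetection_of_fact (isFreeOfRank_pairQuotient_of_sameFiniteQuotients h₁ h₂)` under
the two named-fact hypotheses `h₁ h₂` — the Literature file LANDED (p83264, commit 81b9475ea998), so this is
spelled out here as `stub_profiniteFreenessDetection_of_namedFacts` (hypotheses = the two named facts BY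
NAME, the tree's `(h : Fact)` convention of D-0014).  The registered stub itself stays conditional on
those two undischarged facts (Wilton–Zalesskii Thm. A; Hempel 14.4–14.5): `stub-blocked` on them.
-/

noncomputable section

-- the prescribed namespace `Summit.<P>.<Sub>.…` duplicates `SmoothPoincare4` (P = Sub)
set_option linter.dupNamespace false

namespace Summit.SmoothPoincare4.SmoothPoincare4.Theorems.HeegaardHandlebodyCongruenceClosed.PairRigidityRetraction

open Literature.Topology.FourManifolds Subgroup
open Summit.SmoothPoincare4.SmoothPoincare4.Theorems.WaldhausenPairs.Negative (stabilizeIter_isGroupTrisection)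

/-! ## Transport of `S ⧸ ⟪K⟫ ≅ F_n` along an automorphism -/

/-- An automorphism `θ` of `G` carries the normal closure of `K` onto the normal closure of `θK`:
`θ ⟪K⟫ = ⟪θ K⟫`. [folklore] -/
theorem p2_map_normalClosure_eq {G : Type*} [Group G] (θ : G ≃* G) (K : Subgroup G) :
    (normalClosure (K : Set G)).map θ.toMonoidHom =
      normalClosure ((K.map θ.toMonoidHom : Subgroup G) : Set G) := by
  rw [Subgroup.map_normalClosure _ _ θ.surjective, Subgroup.coe_map]

/-- If `G ⧸ ⟪K⟫` is free of rank `n`, so is `G ⧸ ⟪θK⟫` for every automorphism `θ` of `G`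
(`θ` induces `G ⧸ ⟪K⟫ ≃* G ⧸ θ⟪K⟫ = G ⧸ ⟪θK⟫`, `QuotientGroup.congr`). [folklore] -/
theorem p2_isFreeOfRank_quotient_normalClosure_map {G : Type*} [Group G] (θ : G ≃* G)
    (K : Subgroup G) {n : ℕ} (h : IsFreeOfRank (G ⧸ normalClosure (K : Set G)) n) :
    IsFreeOfRank (G ⧸ normalClosure ((K.map θ.toMonoidHom : Subgroup G) : Set G)) n :=
  h.of_mulEquiv (QuotientGroup.congr (normalClosure (K : Set G))
    (normalClosure ((K.map θ.toMonoidHom : Subgroup G) : Set G)) θ (p2_map_normalClosure_eq θ K))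

/-! ## P2 from the Literature corollary -/

/-- **P2 ⟸ profinite detection of freeness for Heegaard-splitting groups.**  Hypothesis (the
statement of `Literature.Topology.FourManifolds.isFreeOfRank_pairQuotient_of_sameFiniteQuotients`,
unfolded; on paper Wilton–Zalesskii (2019) Thm. A + Hempel Lemmas 14.4–14.5 + Dixon–Formanek–Poland–Ribes):
for all `g k` and `K₁, K₂ ≤ S_g` with `S_g ⧸ ⟪K₁⟫`, `S_g ⧸ ⟪K₂⟫` free of rank `g`, if `S_g ⧸ ⟪K₁ ∪ K₂⟫`
has exactly the finite quotients of `F_k` then it is free of rank `k`.  Conclusion: the registered stub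
P2, by instantiating at `g = 3+3m`, `k = m+1`, `K₁ = N_i` (free quotient of rank `g`:
`stabilizeIter_isGroupTrisection`) and `K₂ = θN₂` (free quotient of rank `g`: the same for `N₂`,
transported along `θ`). -/
theorem stub_profiniteFreenessDetection_of_fact :
    (∀ (g k : ℕ) (K₁ K₂ : Subgroup (SurfaceGroup g)),
      IsFreeOfRank (SurfaceGroup g ⧸ normalClosure (K₁ : Set (SurfaceGroup g))) g →
      IsFreeOfRank (SurfaceGroup g ⧸ normalClosure (K₂ : Set (SurfaceGroup g))) g →
      (∀ (Q : Type) [Group Q] [Finite Q],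
        (∃ f : SurfaceGroup g ⧸ normalClosure ((K₁ : Set (SurfaceGroup g)) ∪ K₂) →* Q,
            Function.Surjective f) ↔
          (∃ f : FreeGroup (Fin k) →* Q, Function.Surjective f)) →
      IsFreeOfRank (SurfaceGroup g ⧸ normalClosure ((K₁ : Set (SurfaceGroup g)) ∪ K₂)) k) →
    ∀ (m : ℕ) (i : Fin 3), i ≠ 2 → ∀ θ : SurfaceGroup (3 + 3 * m) ≃* SurfaceGroup (3 + 3 * m),
      (∀ (Q : Type) [Group Q] [Finite Q],
        (∃ f : SurfaceGroup (3 + 3 * m) ⧸ normalClosure ((s4Kernels.stabilizeIter m i : Set (SurfaceGroup (3 + 3 * m))) ∪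
            ((s4Kernels.stabilizeIter m 2).map θ.toMonoidHom : Subgroup (SurfaceGroup (3 + 3 * m)))) →* Q,
          Function.Surjective f) ↔
        (∃ f : FreeGroup (Fin (m + 1)) →* Q, Function.Surjective f)) →
      IsFreeOfRank (SurfaceGroup (3 + 3 * m) ⧸ normalClosure
        ((s4Kernels.stabilizeIter m i : Set (SurfaceGroup (3 + 3 * m))) ∪
          ((s4Kernels.stabilizeIter m 2).map θ.toMonoidHom : Subgroup (SurfaceGroup (3 + 3 * m))))) (m + 1) :=
  fun hfact m i _ θ hQ =>
    hfact (3 + 3 * m) (m + 1) (s4Kernels.stabilizeIter m i)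
      ((s4Kernels.stabilizeIter m 2).map θ.toMonoidHom)
      ((stabilizeIter_isGroupTrisection m).free_quotient i)
      (p2_isFreeOfRank_quotient_normalClosure_map θ _ ((stabilizeIter_isGroupTrisection m).free_quotient 2))
      hQ

/-- **P2 under the two named facts, by name** (D-0014 convention `(h : Fact)`): Wilton–Zalesskii (2019)
Thm. A for `#ᵏ(S¹ × S²)` on `π₁` (`isFreeOfRank_fundamentalGroup_of_sameFiniteQuotients`) and the
Jaco–Hempel bridge (`exists_closedThreeManifold_fundamentalGroup_pairQuotient`, Hempel Lemmas 14.4–14.5)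
imply the registered stub P2, via the Literature corollary
`isFreeOfRank_pairQuotient_of_sameFiniteQuotients` and `stub_profiniteFreenessDetection_of_fact`. -/
theorem stub_profiniteFreenessDetection_of_namedFacts :
    Literature.Topology.FourManifolds.isFreeOfRank_fundamentalGroup_of_sameFiniteQuotients.{0} →
    Literature.Topology.FourManifolds.exists_closedThreeManifold_fundamentalGroup_pairQuotient.{0} →
    ∀ (m : ℕ) (i : Fin 3), i ≠ 2 → ∀ θ : SurfaceGroup (3 + 3 * m) ≃* SurfaceGroup (3 + 3 * m),
      (∀ (Q : Type) [Group Q] [Finite Q],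
        (∃ f : SurfaceGroup (3 + 3 * m) ⧸ normalClosure ((s4Kernels.stabilizeIter m i : Set (SurfaceGroup (3 + 3 * m))) ∪
            ((s4Kernels.stabilizeIter m 2).map θ.toMonoidHom : Subgroup (SurfaceGroup (3 + 3 * m)))) →* Q,
          Function.Surjective f) ↔
        (∃ f : FreeGroup (Fin (m + 1)) →* Q, Function.Surjective f)) →
      IsFreeOfRank (SurfaceGroup (3 + 3 * m) ⧸ normalClosure
        ((s4Kernels.stabilizeIter m i : Set (SurfaceGroup (3 + 3 * m))) ∪
          ((s4Kernels.stabilizeIter m 2).map θ.toMonoidHom : Subgroup (SurfaceGroup (3 + 3 * m))))) (m + 1) :=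
  fun h₁ h₂ => stub_profiniteFreenessDetection_of_fact (isFreeOfRank_pairQuotient_of_sameFiniteQuotients h₁ h₂)

end Summit.SmoothPoincare4.SmoothPoincare4.Theorems.HeegaardHandlebodyCongruenceClosed.PairRigidityRetraction

end
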